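import Mathlib.Algebra.Lie.Free
import Literature.Algebra.Lie.SurfaceLieAlgebra
import Literature.Algebra.Lie.SurfaceLieAlgebraProofs
import Literature.GroupTheory.CombinatorialGroupTheory.LowerCentralSeriesLieRing
import HarnessLib

/-!
# Stub `stub_freeGroupGrLie` of line `saturated-torsor-descent` for crux
`CongruenceShadows.NilpotentShadowsStandard` (item stmt-SmoothPoincare4-14594)

**Magnus–Witt**: the graded Lie ring `gr(F_n) = ⊕ₖ γₖ/γₖ₊₁` of the lower central series of the
free group `F_n = FreeGroup (Fin n)` is the free Lie ring `L(ℤⁿ) = FreeLieAlgebra ℤ (Fin n)`,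
stated (exactly as the tree states Labute's theorem `Literature.Algebra.Lie.Labute1970_grSurfaceGroup`
for surface groups) through symbol maps `θₖ : F_n → L(ℤⁿ)`: additive on `γₖ₊₁ = lcs k`, image the
bracket-length-`(k+1)` piece `wordGrade ℤ of (k+1)`, kernel `γₖ₊₂` there, letters to letters,
group commutators to Lie brackets.

Proof (route through Labute's theorem, already in the tree). Embed `ι : F_n ↪ S_{n+1}`
(genus-`(n+1)` surface group, `of i ↦ a_{i+1}`) and retract by `r : S_{n+1} ↠ F_n`
(`a_{i+1} ↦ of i`, `a₀, bⱼ ↦ 1`; the relator dies), `r ∘ ι = id`, so that `γₖ F = ι⁻¹(γₖ S)`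
exactly. On the Lie side take Labute's maps `θˢₖ = SurfaceGr.theta n k : S_{n+1} → 𝔰_{n+1}(ℤ)`,
the Lie retraction `ρ : 𝔰_{n+1}(ℤ) → L(ℤⁿ)` (`a_{i+1} ↦ of i`, other letters `↦ 0`) and the
inclusion `j : L(ℤⁿ) → 𝔰_{n+1}(ℤ)` (`of i ↦ a_{i+1}`, so `ρ ∘ j = id`), and put `θₖ = ρ ∘ θˢₖ ∘ ι`.
Additivity, letters and commutators are inherited; the image is `⊆ L_{k+1}` by
`θˢₖ(S) ⊆ 𝔰_{k+1}` and bracket-length bookkeeping, `⊇ L_{k+1}` because the image is a subgroup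
containing all `(k+1)`-fold brackets of letters; the kernel clause uses that `θˢₖ(ι γₖF)` lies
in the range of `j`, on which `ρ` is injective. The transfer lemmas are stated for an arbitrary
such retract diagram `(ι, r, ρ, j)`; the diagram itself is exhibited in `exists_group_retract`,
`exists_lie_retract`. Mathlib + `Literature` only; no definitions, no named facts.
-/

-- the prescribed namespace `Summit.<P>.<Sub>.…` duplicates `SmoothPoincare4` (P = Sub)
set_option linter.dupNamespace false

open scoped commutatorElement

namespace Summit.SmoothPoincare4.SmoothPoincare4.Theorems.NilpotentShadowsStandard.SaturatedTorsorDescent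

open Literature.Algebra.Lie Literature.GroupTheory.CombinatorialGroupTheory
open Literature.Topology.FourManifolds

namespace FreeGroupGrLie

/-! ## Bracket-length bookkeeping and `γ` under homomorphisms -/

/-- If every `f x` has bracket length one in the family `g`, then the length-`m` piece of `f` lies
in the length-`m` piece of `g`. [folklore] -/
theorem wordGrade_le_wordGrade {R : Type*} [CommRing R] {X Y L : Type*} [LieRing L] [LieAlgebra R L]
    {f : X → L} {g : Y → L} (h : ∀ x, f x ∈ wordGrade R g 1) (m : ℕ) :
    wordGrade R f m ≤ wordGrade R g m := by
  refine Submodule.span_le.2 ?_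
  rintro _ ⟨w, hw, rfl⟩
  have hw' : w.length = m := hw
  subst hw'
  clear hw
  induction w using FreeMagma.recOnMul with
  | ih1 x => exact h x
  | ih2 u v hu hv => exact lie_mem_wordGrade hu hv

/-- Homomorphisms map `γₖ` into `γₖ`. [folklore] -/
theorem map_mem_lcs {G K : Type*} [Group G] [Group K] (f : G →* K) {k : ℕ} {x : G} (hx : x ∈ lcs G k) :
    f x ∈ lcs K k := by
  have h : (lcs G k).map f ≤ lcs K k := by
    rw [Subgroup.map_lowerCentralSeries]
    exact Subgroup.lowerCentralSeries_mono k le_top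
  exact h ⟨x, hx, rfl⟩

/-! ## The retract diagram `F_n ⇄ S_{n+1}`, `L(ℤⁿ) ⇄ 𝔰_{n+1}(ℤ)` -/

/-- **Group retract**: `ι : F_n → S_{n+1}`, `of i ↦ a_{i+1}`, has a left inverse `r : S_{n+1} → F_n`
(`a_{i+1} ↦ of i`, `a₀ ↦ 1`, `bⱼ ↦ 1`; `r` kills the surface relator). [folklore] -/
theorem exists_group_retract (n : ℕ) :
    ∃ (ι : FreeGroup (Fin n) →* SurfaceGroup (n + 1)) (r : SurfaceGroup (n + 1) →* FreeGroup (Fin n)),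
      (∀ x, r (ι x) = x) ∧ ∀ i, ι (FreeGroup.of i) = SurfaceGroup.a (Fin.succ i) := by
  set f : Fin (n + 1) × Bool → FreeGroup (Fin n) := fun x =>
    if x.2 then 1 else (Fin.cons 1 (fun i => FreeGroup.of i) : Fin (n + 1) → FreeGroup (Fin n)) x.1
  have hfa : ∀ i : Fin n, f (Fin.succ i, false) = FreeGroup.of i := fun i => by simp [f]
  have hf1 : ∀ w ∈ ({surfaceRelator (n + 1)} : Set (FreeGroup (surfaceGen (n + 1)))),
      FreeGroup.lift f w = 1 := by
    intro w hw
    rw [Set.mem_singleton_iff] at hw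
    subst hw
    unfold surfaceRelator
    rw [map_list_prod, List.map_map]
    apply List.prod_eq_one
    intro x hx
    rw [List.mem_map] at hx
    obtain ⟨i, -, rfl⟩ := hx
    simp [genA, genB, f]
  refine ⟨FreeGroup.lift fun i => SurfaceGroup.a (Fin.succ i), PresentedGroup.toGroup hf1, ?_,
    fun i => FreeGroup.lift_apply_of⟩
  intro x
  suffices h : (PresentedGroup.toGroup hf1).comp (FreeGroup.lift fun i => SurfaceGroup.a (Fin.succ i)) =
      MonoidHom.id _ from DFunLike.congr_fun h x
  refine FreeGroup.ext_hom _ _ fun i => ?_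
  rw [MonoidHom.comp_apply, MonoidHom.id_apply, FreeGroup.lift_apply_of, SurfaceGroup.a,
    PresentedGroup.toGroup.of]
  exact hfa i

/-- **Lie retract**: the Lie retraction `ρ : 𝔰_{n+1}(ℤ) → L(ℤⁿ)` (`a_{i+1} ↦ of i`, `a₀, bⱼ ↦ 0`;
the relation `∑ ⁅aⱼ, bⱼ⁆` goes to `∑ ⁅_, 0⁆ = 0`) and the inclusion `j : L(ℤⁿ) → 𝔰_{n+1}(ℤ)`
(`of i ↦ a_{i+1}`), with `ρ ∘ j = id` and `ρ` of bracket length `≤ 1` on letters. [folklore] -/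
theorem exists_lie_retract (n : ℕ) :
    ∃ (ρ : SurfaceLieAlgebra ℤ (n + 1) →ₗ⁅ℤ⁆ FreeLieAlgebra ℤ (Fin n))
      (j : FreeLieAlgebra ℤ (Fin n) →ₗ⁅ℤ⁆ SurfaceLieAlgebra ℤ (n + 1)),
      (∀ u, ρ (j u) = u) ∧ (∀ i, j (FreeLieAlgebra.of ℤ i) = SurfaceLieAlgebra.a ℤ (n + 1) (Fin.succ i)) ∧
      (∀ i, ρ (SurfaceLieAlgebra.a ℤ (n + 1) (Fin.succ i)) = FreeLieAlgebra.of ℤ i) ∧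
      ∀ x, ρ (SurfaceLieAlgebra.gen ℤ (n + 1) x) ∈
        wordGrade ℤ (FreeLieAlgebra.of ℤ : Fin n → FreeLieAlgebra ℤ (Fin n)) 1 := by
  set g : Fin (n + 1) × Bool → FreeLieAlgebra ℤ (Fin n) := fun x =>
    if x.2 then 0 else (Fin.cons 0 (fun i => FreeLieAlgebra.of ℤ i) : Fin (n + 1) → FreeLieAlgebra ℤ (Fin n)) x.1
  have hg0 : ∑ i : Fin (n + 1), ⁅g (i, false), g (i, true)⁆ = 0 := by simp [g]
  have hga : ∀ i : Fin n, g (Fin.succ i, false) = FreeLieAlgebra.of ℤ i := fun i => by simp [g]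
  have hgz : g (0, false) = 0 := by simp [g]
  have hgb : ∀ k : Fin (n + 1), g (k, true) = 0 := fun k => rfl
  -- the four properties, in the maps' own typing (the packaging below is up to defeq of instances)
  have h1 : ∀ u, SurfaceLieAlgebra.lift g hg0
      (FreeLieAlgebra.lift ℤ (fun i => SurfaceLieAlgebra.a ℤ (n + 1) (Fin.succ i)) u) = u := by
    intro u
    suffices h : (SurfaceLieAlgebra.lift g hg0).comp
        (FreeLieAlgebra.lift ℤ fun i => SurfaceLieAlgebra.a ℤ (n + 1) (Fin.succ i)) = LieHom.id from
      LieHom.congr_fun h u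
    exact FreeLieAlgebra.hom_ext fun i => by
      show SurfaceLieAlgebra.lift g hg0 (FreeLieAlgebra.lift ℤ
          (fun i => SurfaceLieAlgebra.a ℤ (n + 1) (Fin.succ i)) (FreeLieAlgebra.of ℤ i)) = FreeLieAlgebra.of ℤ i
      rw [FreeLieAlgebra.lift_of_apply, SurfaceLieAlgebra.a, SurfaceLieAlgebra.lift_gen, hga]
  have h2 : ∀ i, FreeLieAlgebra.lift ℤ (fun i => SurfaceLieAlgebra.a ℤ (n + 1) (Fin.succ i)) (FreeLieAlgebra.of ℤ i) =
      SurfaceLieAlgebra.a ℤ (n + 1) (Fin.succ i) := fun i => FreeLieAlgebra.lift_of_apply _ i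
  have h3 : ∀ i, SurfaceLieAlgebra.lift g hg0 (SurfaceLieAlgebra.a ℤ (n + 1) (Fin.succ i)) = FreeLieAlgebra.of ℤ i := by
    intro i
    rw [SurfaceLieAlgebra.a, SurfaceLieAlgebra.lift_gen, hga]
  have h4 : ∀ x, SurfaceLieAlgebra.lift g hg0 (SurfaceLieAlgebra.gen ℤ (n + 1) x) ∈
      wordGrade ℤ (FreeLieAlgebra.of ℤ : Fin n → FreeLieAlgebra ℤ (Fin n)) 1 := by
    rintro ⟨k, b⟩
    rw [SurfaceLieAlgebra.lift_gen]
    cases b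
    · induction k using Fin.cases with
      | zero => rw [hgz]; exact zero_mem _
      | succ i => rw [hga]; exact mem_wordGrade_one _ i
    · rw [hgb]; exact zero_mem _
  exact ⟨SurfaceLieAlgebra.lift g hg0, FreeLieAlgebra.lift ℤ fun i => SurfaceLieAlgebra.a ℤ (n + 1) (Fin.succ i),
    h1, h2, h3, h4⟩

/-! ## Transfer along a retract diagram -/

variable {n : ℕ} {ι : FreeGroup (Fin n) →* SurfaceGroup (n + 1)} {r : SurfaceGroup (n + 1) →* FreeGroup (Fin n)}
  {ρ : SurfaceLieAlgebra ℤ (n + 1) →ₗ⁅ℤ⁆ FreeLieAlgebra ℤ (Fin n)}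
  {j : FreeLieAlgebra ℤ (Fin n) →ₗ⁅ℤ⁆ SurfaceLieAlgebra ℤ (n + 1)}

/-- `γₖ F_n = ι⁻¹(γₖ S_{n+1})` for a retract `r ∘ ι = id`. [folklore] -/
theorem iota_mem_lcs_iff (hr : ∀ x, r (ι x) = x) {k : ℕ} {x : FreeGroup (Fin n)} :
    ι x ∈ lcs (SurfaceGroup (n + 1)) k ↔ x ∈ lcs (FreeGroup (Fin n)) k :=
  ⟨fun h => by simpa [hr] using map_mem_lcs r h, map_mem_lcs ι⟩

variable (n) in
/-- `θˢₖ 1 = 0`. [folklore] -/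
theorem theta_one (k : ℕ) : SurfaceGr.theta n k (1 : SurfaceGroup (n + 1)) = 0 :=
  SurfaceGr.theta_eq_of n (zero_mem _) (by rw [map_zero, toGr_one])

variable (n) in
/-- `θˢₖ x⁻¹ = -θˢₖ x` on `γₖ`. [folklore] -/
theorem theta_inv {k : ℕ} {x : SurfaceGroup (n + 1)} (hx : x ∈ lcs (SurfaceGroup (n + 1)) k) :
    SurfaceGr.theta n k x⁻¹ = -SurfaceGr.theta n k x := by
  have h := SurfaceGr.theta_mul n (inv_mem hx) hx
  rw [inv_mul_cancel, theta_one] at h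
  exact eq_neg_of_add_eq_zero_left h.symm

/-- (1) `θₖ = ρ ∘ θˢₖ ∘ ι` is additive on `γₖ`. [folklore] -/
theorem thetaF_mul (hr : ∀ x, r (ι x) = x) {k : ℕ} {x y : FreeGroup (Fin n)}
    (hx : x ∈ lcs (FreeGroup (Fin n)) k) (hy : y ∈ lcs (FreeGroup (Fin n)) k) :
    ρ (SurfaceGr.theta n k (ι (x * y))) = ρ (SurfaceGr.theta n k (ι x)) + ρ (SurfaceGr.theta n k (ι y)) := by
  rw [map_mul, SurfaceGr.theta_mul n ((iota_mem_lcs_iff hr).2 hx) ((iota_mem_lcs_iff hr).2 hy), map_add]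

/-- `θₖ 1 = 0`. [folklore] -/
theorem thetaF_one (k : ℕ) : ρ (SurfaceGr.theta n k (ι 1)) = 0 := by
  rw [map_one, theta_one, map_zero]

/-- `θₖ x⁻¹ = -θₖ x` on `γₖ`. [folklore] -/
theorem thetaF_inv (hr : ∀ x, r (ι x) = x) {k : ℕ} {x : FreeGroup (Fin n)} (hx : x ∈ lcs (FreeGroup (Fin n)) k) :
    ρ (SurfaceGr.theta n k (ι x⁻¹)) = -ρ (SurfaceGr.theta n k (ι x)) := by
  rw [map_inv, theta_inv n ((iota_mem_lcs_iff hr).2 hx), map_neg]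

/-- (4) `θ₀ (of i) = of i`. [folklore] -/
theorem thetaF_of (hι : ∀ i, ι (FreeGroup.of i) = SurfaceGroup.a (Fin.succ i))
    (hρa : ∀ i, ρ (SurfaceLieAlgebra.a ℤ (n + 1) (Fin.succ i)) = FreeLieAlgebra.of ℤ i) (i : Fin n) :
    ρ (SurfaceGr.theta n 0 (ι (FreeGroup.of i))) = FreeLieAlgebra.of ℤ i := by
  rw [hι, SurfaceGr.theta_a, hρa]

/-- (5) `θ` turns group commutators into Lie brackets. [folklore] -/
theorem thetaF_commutator (hr : ∀ x, r (ι x) = x) {m k : ℕ} {x y : FreeGroup (Fin n)}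
    (hx : x ∈ lcs (FreeGroup (Fin n)) m) (hy : y ∈ lcs (FreeGroup (Fin n)) k) :
    ρ (SurfaceGr.theta n (m + k + 1) (ι ⁅x, y⁆)) =
      ⁅ρ (SurfaceGr.theta n m (ι x)), ρ (SurfaceGr.theta n k (ι y))⁆ := by
  rw [map_commutatorElement,
    SurfaceGr.theta_commutator n ((iota_mem_lcs_iff hr).2 hx) ((iota_mem_lcs_iff hr).2 hy), LieHom.map_lie]

/-- `ρ` maps `𝔰_{n+1}(ℤ)_m` into `L(ℤⁿ)_m` as soon as it has bracket length `≤ 1` on letters. [folklore] -/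
theorem rho_mem_wordGrade
    (hρ1 : ∀ x, ρ (SurfaceLieAlgebra.gen ℤ (n + 1) x) ∈
      wordGrade ℤ (FreeLieAlgebra.of ℤ : Fin n → FreeLieAlgebra ℤ (Fin n)) 1)
    {m : ℕ} {u : SurfaceLieAlgebra ℤ (n + 1)} (hu : u ∈ SurfaceLieAlgebra.grade ℤ (n + 1) m) :
    ρ u ∈ wordGrade ℤ (FreeLieAlgebra.of ℤ : Fin n → FreeLieAlgebra ℤ (Fin n)) m := by
  have h : ρ u ∈ (wordGrade ℤ (SurfaceLieAlgebra.gen ℤ (n + 1)) m).map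
      (ρ : SurfaceLieAlgebra ℤ (n + 1) →ₗ[ℤ] FreeLieAlgebra ℤ (Fin n)) :=
    Submodule.mem_map_of_mem hu
  rw [map_wordGrade] at h
  exact wordGrade_le_wordGrade (fun x => hρ1 x) m h

/-- (2, `⊆`) `θₖ x ∈ L_{k+1}`. [folklore] -/
theorem thetaF_mem
    (hρ1 : ∀ x, ρ (SurfaceLieAlgebra.gen ℤ (n + 1) x) ∈
      wordGrade ℤ (FreeLieAlgebra.of ℤ : Fin n → FreeLieAlgebra ℤ (Fin n)) 1)
    (k : ℕ) (x : FreeGroup (Fin n)) :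
    ρ (SurfaceGr.theta n k (ι x)) ∈ wordGrade ℤ (FreeLieAlgebra.of ℤ : Fin n → FreeLieAlgebra ℤ (Fin n)) (k + 1) :=
  rho_mem_wordGrade hρ1 (SurfaceGr.theta_mem n k (ι x))

/-- (2, `⊇` on words) every `(k+1)`-fold bracket of letters is a value of `θₖ` on `γₖ`. [folklore] -/
theorem exists_thetaF_eq_bracketWord (hr : ∀ x, r (ι x) = x)
    (hι : ∀ i, ι (FreeGroup.of i) = SurfaceGroup.a (Fin.succ i))
    (hρa : ∀ i, ρ (SurfaceLieAlgebra.a ℤ (n + 1) (Fin.succ i)) = FreeLieAlgebra.of ℤ i) (w : FreeMagma (Fin n)) :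
    ∀ k, w.length = k + 1 → ∃ x ∈ lcs (FreeGroup (Fin n)) k,
      ρ (SurfaceGr.theta n k (ι x)) = bracketWord (FreeLieAlgebra.of ℤ) w := by
  induction w using FreeMagma.recOnMul with
  | ih1 i =>
    intro k hk
    obtain rfl : k = 0 := by change 1 = k + 1 at hk; omega
    exact ⟨FreeGroup.of i, Subgroup.mem_top _, by rw [thetaF_of hι hρa, bracketWord_of]⟩
  | ih2 u v hu hv =>
    intro k hk
    change u.length + v.length = k + 1 at hk
    obtain ⟨p, hp⟩ : ∃ p, u.length = p + 1 := ⟨u.length - 1, by have := FreeMagma.length_pos u; omega⟩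
    obtain ⟨q, hq⟩ : ∃ q, v.length = q + 1 := ⟨v.length - 1, by have := FreeMagma.length_pos v; omega⟩
    obtain ⟨x, hx, hxu⟩ := hu p hp
    obtain ⟨y, hy, hyv⟩ := hv q hq
    obtain rfl : k = p + q + 1 := by omega
    exact ⟨⁅x, y⁆, commutator_mem_lcs hx hy, by rw [thetaF_commutator hr hx hy, hxu, hyv, bracketWord_mul]⟩

/-- (2) `θₖ(γₖ) = L_{k+1}`. [folklore] -/
theorem thetaF_image (hr : ∀ x, r (ι x) = x) (hι : ∀ i, ι (FreeGroup.of i) = SurfaceGroup.a (Fin.succ i))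
    (hρa : ∀ i, ρ (SurfaceLieAlgebra.a ℤ (n + 1) (Fin.succ i)) = FreeLieAlgebra.of ℤ i)
    (hρ1 : ∀ x, ρ (SurfaceLieAlgebra.gen ℤ (n + 1) x) ∈
      wordGrade ℤ (FreeLieAlgebra.of ℤ : Fin n → FreeLieAlgebra ℤ (Fin n)) 1) (k : ℕ) :
    (fun x => ρ (SurfaceGr.theta n k (ι x))) '' (lcs (FreeGroup (Fin n)) k : Set (FreeGroup (Fin n))) =
      wordGrade ℤ (FreeLieAlgebra.of ℤ : Fin n → FreeLieAlgebra ℤ (Fin n)) (k + 1) := by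
  refine Set.Subset.antisymm ?_ ?_
  · rintro _ ⟨x, -, rfl⟩
    exact thetaF_mem hρ1 k x
  · -- the image is an additive subgroup containing the brackets of letters
    obtain ⟨S, hS⟩ : ∃ S : AddSubgroup (FreeLieAlgebra ℤ (Fin n)), (S : Set (FreeLieAlgebra ℤ (Fin n))) =
        (fun x => ρ (SurfaceGr.theta n k (ι x))) '' (lcs (FreeGroup (Fin n)) k : Set (FreeGroup (Fin n))) :=
      ⟨{ carrier := (fun x => ρ (SurfaceGr.theta n k (ι x))) '' (lcs (FreeGroup (Fin n)) k : Set (FreeGroup (Fin n))),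
          zero_mem' := ⟨1, one_mem _, thetaF_one k⟩,
          add_mem' := by
            rintro _ _ ⟨x, hx, rfl⟩ ⟨y, hy, rfl⟩
            exact ⟨x * y, mul_mem hx hy, thetaF_mul hr hx hy⟩,
          neg_mem' := by
            rintro _ ⟨x, hx, rfl⟩
            exact ⟨x⁻¹, inv_mem hx, thetaF_inv hr hx⟩ }, rfl⟩
    have h : wordGrade ℤ (FreeLieAlgebra.of ℤ : Fin n → FreeLieAlgebra ℤ (Fin n)) (k + 1) ≤ S.toIntSubmodule := by
      rw [wordGrade, Submodule.span_le]
      rintro _ ⟨w, hw, rfl⟩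
      show bracketWord (FreeLieAlgebra.of ℤ) w ∈ (S : Set (FreeLieAlgebra ℤ (Fin n)))
      rw [hS]
      exact exists_thetaF_eq_bracketWord hr hι hρa w k hw
    rw [← hS]
    intro u hu
    exact h hu

/-- (3, key, degree `0`) `θˢ₀ (ι x)` lies in the range of `j` (the Lie subring of `𝔰_{n+1}(ℤ)`
generated by the `a_{i+1}`). [folklore] -/
theorem theta_iota_mem_range_zero (hι : ∀ i, ι (FreeGroup.of i) = SurfaceGroup.a (Fin.succ i))
    (hj : ∀ i, j (FreeLieAlgebra.of ℤ i) = SurfaceLieAlgebra.a ℤ (n + 1) (Fin.succ i)) (x : FreeGroup (Fin n)) :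
    SurfaceGr.theta n 0 (ι x) ∈ j.range := by
  induction x using FreeGroup.induction_on with
  | C1 => rw [map_one, theta_one]; exact zero_mem _
  | of i =>
    rw [hι, SurfaceGr.theta_a]
    exact (LieHom.mem_range _ _).2 ⟨FreeLieAlgebra.of ℤ i, hj i⟩
  | inv_of i hi =>
    rw [map_inv, theta_inv n (Subgroup.mem_top _)]
    exact neg_mem hi
  | mul x y hx hy =>
    rw [map_mul, SurfaceGr.theta_mul n (Subgroup.mem_top _) (Subgroup.mem_top _)]
    exact add_mem hx hy

/-- (3, key) on `γₖ F_n` the values `θˢₖ (ι x)` lie in the range of `j`: induction on `k` along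
`γₖ₊₁ = ⟨⁅γₖ, F⁆⟩`, using additivity and the commutator clause of Labute's maps. [folklore] -/
theorem theta_iota_mem_range (hr : ∀ x, r (ι x) = x) (hι : ∀ i, ι (FreeGroup.of i) = SurfaceGroup.a (Fin.succ i))
    (hj : ∀ i, j (FreeLieAlgebra.of ℤ i) = SurfaceLieAlgebra.a ℤ (n + 1) (Fin.succ i)) :
    ∀ k, ∀ x ∈ lcs (FreeGroup (Fin n)) k, SurfaceGr.theta n k (ι x) ∈ j.range := by
  intro k
  induction k with
  | zero =>
    intro x _
    exact theta_iota_mem_range_zero hι hj x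
  | succ k ih =>
    intro x hx
    have hx' : x ∈ Subgroup.closure {g : FreeGroup (Fin n) | ∃ p ∈ lcs (FreeGroup (Fin n)) k,
        ∃ q ∈ (⊤ : Subgroup (FreeGroup (Fin n))), ⁅p, q⁆ = g} := hx
    refine Subgroup.closure_induction (p := fun x _ => SurfaceGr.theta n (k + 1) (ι x) ∈ j.range)
      ?_ ?_ ?_ ?_ hx'
    · rintro _ ⟨p, hp, q, -, rfl⟩
      have h := SurfaceGr.theta_commutator n (m := k) (n := 0) ((iota_mem_lcs_iff hr).2 hp)
        (Subgroup.mem_top (ι q))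
      rw [add_zero] at h
      rw [map_commutatorElement, h]
      exact LieSubalgebra.lie_mem _ (ih p hp) (theta_iota_mem_range_zero hι hj q)
    · rw [map_one, theta_one]; exact zero_mem _
    · intro x y hx hy hx' hy'
      have hx1 : x ∈ lcs (FreeGroup (Fin n)) (k + 1) := hx
      have hy1 : y ∈ lcs (FreeGroup (Fin n)) (k + 1) := hy
      rw [map_mul, SurfaceGr.theta_mul n ((iota_mem_lcs_iff hr).2 hx1) ((iota_mem_lcs_iff hr).2 hy1)]
      exact add_mem hx' hy'
    · intro x hx hx'
      have hx1 : x ∈ lcs (FreeGroup (Fin n)) (k + 1) := hx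
      rw [map_inv, theta_inv n ((iota_mem_lcs_iff hr).2 hx1)]
      exact neg_mem hx'

/-- (3) `ker θₖ ∩ γₖ = γₖ₊₁`. [folklore] -/
theorem thetaF_eq_zero_iff (hr : ∀ x, r (ι x) = x) (hι : ∀ i, ι (FreeGroup.of i) = SurfaceGroup.a (Fin.succ i))
    (hj : ∀ i, j (FreeLieAlgebra.of ℤ i) = SurfaceLieAlgebra.a ℤ (n + 1) (Fin.succ i)) (hρj : ∀ u, ρ (j u) = u)
    {k : ℕ} {x : FreeGroup (Fin n)} (hx : x ∈ lcs (FreeGroup (Fin n)) k) :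
    ρ (SurfaceGr.theta n k (ι x)) = 0 ↔ x ∈ lcs (FreeGroup (Fin n)) (k + 1) := by
  have hxS : ι x ∈ lcs (SurfaceGroup (n + 1)) k := (iota_mem_lcs_iff hr).2 hx
  rw [← iota_mem_lcs_iff hr, ← SurfaceGr.theta_eq_zero_iff n hxS]
  constructor
  · intro h
    obtain ⟨u, hu⟩ := (LieHom.mem_range _ _).1 (theta_iota_mem_range hr hι hj k x hx)
    rw [← hu, hρj] at h
    rw [← hu, h, map_zero]
  · intro h
    rw [h, map_zero]

end FreeGroupGrLie

open FreeGroupGrLie in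
/-- Stub 4a · **Magnus–Witt for `F_n`** (`gr(F_n) ≅ L(ℤⁿ)`, the free Lie ring, through symbol maps
`θₖ : F_n → L(ℤⁿ)` exactly as `Literature.Algebra.Lie.Labute1970_grSurfaceGroup` states Labute's
theorem): `θₖ` is additive on `γₖ₊₁ = lcs k`, has image `L_{k+1}` and kernel `γₖ₊₂` there, sends
letters to letters and group commutators to Lie brackets. Derived here from Labute's theorem for the
surface group `S_{n+1}` via the retract `F_n ↪ S_{n+1} ↠ F_n`.
[cite: Labute1970, §1 (gr(F) = L, Magnus–Witt) and Theorem p. 17] -/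
theorem stub_freeGroupGrLie : ∀ n : ℕ, ∃ θ : ℕ → FreeGroup (Fin n) → FreeLieAlgebra ℤ (Fin n), (∀ k, ∀ x ∈ (⊤ : Subgroup (FreeGroup (Fin n))).lowerCentralSeries k, ∀ y ∈ (⊤ : Subgroup (FreeGroup (Fin n))).lowerCentralSeries k, θ k (x * y) = θ k x + θ k y) ∧ (∀ k, θ k '' ((⊤ : Subgroup (FreeGroup (Fin n))).lowerCentralSeries k) = Literature.Algebra.Lie.wordGrade ℤ (FreeLieAlgebra.of ℤ : Fin n → FreeLieAlgebra ℤ (Fin n)) (k + 1)) ∧ (∀ k, ∀ x ∈ (⊤ : Subgroup (FreeGroup (Fin n))).lowerCentralSeries k, θ k x = 0 ↔ x ∈ (⊤ : Subgroup (FreeGroup (Fin n))).lowerCentralSeries (k + 1)) ∧ (∀ i : Fin n, θ 0 (FreeGroup.of i) = FreeLieAlgebra.of ℤ i) ∧ (∀ j k, ∀ x ∈ (⊤ : Subgroup (FreeGroup (Fin n))).lowerCentralSeries j, ∀ y ∈ (⊤ : Subgroup (FreeGroup (Fin n))).lowerCentralSeries k, θ (j + k + 1) ⁅x, y⁆ =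 ⁅θ j x, θ k y⁆) := by
  intro n
  obtain ⟨ι, r, hr, hι⟩ := exists_group_retract n
  obtain ⟨ρ, j, hρj, hj, hρa, hρ1⟩ := exists_lie_retract n
  refine ⟨fun k x => ρ (SurfaceGr.theta n k (ι x)), ?_, ?_, ?_, ?_, ?_⟩
  · intro k x hx y hy
    exact thetaF_mul hr hx hy
  · intro k
    exact thetaF_image hr hι hρa hρ1 k
  · intro k x hx
    exact thetaF_eq_zero_iff hr hι hj hρj hx
  · intro i
    exact thetaF_of hι hρa i
  · intro m k x hx y hy
    exact thetaF_commutator hr hx hy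

end Summit.SmoothPoincare4.SmoothPoincare4.Theorems.NilpotentShadowsStandard.SaturatedTorsorDescent
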